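import Literature.MathematicalPhysics.QuantumFieldTheory.Balaban1983to89.Node00.RStepRepr218
import Literature.MathematicalPhysics.QuantumFieldTheory.Balaban1983to89.T4ObservableTelescope

/-!
# N21 (NE7c), strategy s3 «alternative currency», file 20 — SHARP FACTORS RIDE THROUGH THE TYPED ℝ: the (0.3) quotient keeps the
# mixture road's `hXs` shape on FIBRE-INDEPENDENT, SELECTOR-MONOTONE occurrences, with (0.4) per summand under satisfiable provisos

Seat `pub-ymgap-dag-n21-e` (R141 (C) fan-out, node N21 = NE7c `T4IndicatorShell.ShellWeightBound`, strategy s3), g8.  Lane: `--kind proof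
--supports stmt-QuantumFields-20292 --as helper` (K3⁗ `SpineGivenEndpointR13Sep`).  Count-neutral.

THE QUESTION.  Files 15∕16 (p500803∕p502670) ran the mixture road's falsifier (K-ii) «does a term remainder's DEFINITION use a threshold?»
against def-R's typed 𝐑 (FILE 7 `Node00.rstepOfSel`; assembled density `B15.BasicStep.RopReal (rterm r) sel fib`, [Balaban1989LargeFieldI] (0.3)
p. 176): it FIRES at the value level (the quotient reads the pinned `χ`-factors in numerator AND denominator), is neutralised on spectators and BY
SUPPORT, and BITES at small-field occurrences ON the fibre bond sets ((O-mix-4), file 16's `D`).  The lens (`LENS-nearmiss.md` v9.0, Cards 26∕28)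
left two READ-ONLY kill-tests for def-R ∕ NODE O on the HISTORIES road: (KT-26) does the selector `sel` read window-age labels?  (KT-28) does
`fibOfSeq` contain window-cube bonds?  THIS FILE: the SAME two answers decide the mixture road, and decide it COMPLETELY off the fibre.

Write each piece as `t_a = c_a · f_a` — `c_a` the randomised SHARP factor of the occurrences the mixture road gives multipliers to (a product
of small∕large-field indicators at the threshold vector `S`; here any nonnegative function), `f_a` the rest (threshold-free).  Suppose
(KT-28 «no») `c_a` and `c_{sel a}` are FIBRE-INDEPENDENT of `fib a` (`T4DressedR.FibreIndep`), and (KT-26 «no», weak form) the selector is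
MONOTONE on them, `c_a ≤ c_{sel a}` pointwise (print: the receiving history `Z″` coincides with `Z` off `Z′`, p. 176).  Then:

* §1 (one normalised term) `normTerm(fib a)(c″f″)(c f) = [c″ ≠ 0]·c·normTerm(fib a)(f″)(f)` pointwise (`normTerm_factor_mul`); `= c·c″·(…)` for an
  idempotent `c″` (`…_of_idem`); **`= c·normTerm(f″)(f)` when `c ≤ c″`** (`…_of_le`) — the SENDING sharp factor survives ℝ verbatim, remainder threshold-free, `≥ 0`.
* §2 (the (0.3) density, indexed by the OLD index `a` — admissible at the apex, where `T4MatchingAssembly.StringHybridNE7` is ∃ over the index type,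
  file 17 p506004) **`ℝρ = Σ_a c_a · normTerm(fib a)(f_{sel a})(f_a)`** (`ropReal_factor_eq_sum_of_le`); without monotonicity the factor is
  `[c_{sel a} ≠ 0]·c_a` (`ropReal_factor_eq_sum`) ∕ `c_a·c_{sel a}` (`…_of_idem`: a sharp product over the UNION of the two occurrence sets).
* §3 (threshold-parametric families `c = c^S`, any measure on the multiplier space) the multiplier-integral of the post-ℝ density is
  `Σ_a (∫ c^S_a dS)·normTerm(fib a)(f_{sel a})(f_a)` (`integral_ropReal_family_eq_of_le`) — 13a∕14a's `hXs`∕`hA` pair (p491254∕p495878) SURVIVES ℝ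
  with the same occurrence set; (O-mix-4)'s `D` is needed ONLY for occurrences on fibre bonds.
* §4 ((0.4) per summand, [Balaban1989LargeFieldI] (0.4) p. 176 ∕ (1.102) p. 201) under `T4ObservableTelescope.TermProvisos (fib a) f_{sel a} f_a C` —
  provisos on the THRESHOLD-FREE parts, hence SATISFIABLE (b01's `hden : ∀ V, ∫⌈ t_{sel a} ≠ 0` is not, once `t_{sel a}` carries an indicator with
  zeros off the fibre) —: `∫ normTerm(fib a)(c″f″)(c f) = ∫ f·[c″ ≠ 0]·c` (`integral_factor_normTerm_eq`), so the MASS DEFECT of the typed (0.3) on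
  indicator-carrying pieces is exactly the sending mass on the receiver's zero set (`integral_defect_factor_eq`, ≥ 0), it VANISHES under
  `c ≤ c″` (`integral_factor_normTerm_eq_of_le`), and then **`∫ ℝρ = Σ_a ∫ t_a`** (`integral_ropReal_factor_eq_of_le`) and every OLD-CLASS weight is
  preserved (`classSum_ropReal_factor_eq_of_le`) — E1∕E2 and every N20-shape CLASS binder of files 12∕17∕19 (p485985∕p506004∕p509394) at every
  threshold vector pass through ℝ unchanged.
* §5 reads §2∕§4 at FILE 7's letters: `rterm r a = r.χ a · r.TexpA a` with the pinned factor split `r.χ a = cOut a · cFib a` (off-fibre × on-fibre),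
  `cOut` fibre-independent and `sel`-monotone, `cFib` folded into the threshold-free slot `g a := cFib a · r.TexpA a`:
  `RopReal (rterm r) sel fib = Σ_a cOut a · normTerm(fib a)(g (sel a))(g a)` and FILE 7's `integral_sum_rstepOfSel` with its `hprov` REPLACED by
  «provisos on `g` + off-fibre monotonicity» (`integral_sum_rstepOfSel_eq_of_le`).  FILE 8's `rstepSlotOfRecord` is the instance `rstepOfSel_sliceOfRecord` (`rfl`).
* §6 GUARD: where the receiver vanishes the typed (0.3) kills the sender's contribution (`normTerm_eq_zero∕ne_old_of_receiver_zero`): `c ≤ c″` is load-bearing.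

HONEST FRAMING.  NE7c is NOT PRINTED and NOT PROVED.  [folklore] algebra of b01's `normTerm` plus two Fubini identities already in the tree
(`T4DressedR.fibreIntegral_mul_of_fibreIndep`, b01 `integral_normTerm_eq` via `TermProvisos`).  The kill-test answers (KT-26∕KT-28) are def-R's ∕
NODE O's (`PpSelOfRecord` ∕ `fibOfSeq`); here they are HYPOTHESES, as on the histories road after lens Cards 26∕28 — one answer serves both roads.
The mixture (a convex combination of print's SHARP procedure over admissible threshold vectors) is design, NOT print verbatim; (M1) for print's
sharp procedure untouched; nothing of Bałaban's asserted; N21 NOT discharged; count-neutral; one finite 𝕋⁴ at fixed `ε`; NOT ℝ⁴ ∕ OS ∕ gap ∕ Clay.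

CITATION HEADER (lean-in-tree rule 2026-08-18).  BY NAME: b01 `B15.BasicStep.fibreIntegral` ∕ `normTerm` ∕ `RopReal` ∕ `integral_normTerm_eq`
([Balaban1989LargeFieldI] (0.3)–(0.4) p. 176, (1.102) p. 201, typed there with locators); `T4DressedR.FibreIndep` ∕ `fibreIntegral_mul_of_fibreIndep`;
`T4ObservableTelescope.TermProvisos` ∕ `normTerm_mul_eq_of_fibreIndep`; `T4JointDressing.fibreIntegral_nonneg`; def-R FILE 7 `Node00.rterm` ∕ `rstepOfSel` ∕
`sum_rstepOfSel_eq`.  Context only (SHAPE): [Balaban1989LargeFieldI] (0.3)–(0.4) p. 176 — *"(ℝρ)(V) = Σ_Z ρ(Z″,V) ∫dV⌈_{Z′}ρ(Z,V) ∕ ∫dV⌈_{Z′}ρ(Z″,V)"*, *"∫dV(ℝρ)(V) = ∫dV ρ(V)"*.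

WHAT IS PROVED ([folklore]).  §1 `fibreIntegral_factor_mul` · ★ `normTerm_factor_mul` · `normTerm_factor_mul_of_idem` · ★ `normTerm_factor_mul_of_le` ·
`normTerm_factor_nonneg`; §2 `ropReal_factor_eq_sum` · `ropReal_factor_eq_sum_of_idem` · ★★ `ropReal_factor_eq_sum_of_le`; §3 ★ `integral_ropReal_family_eq_of_le`;
§4 ★ `integral_factor_normTerm_eq` · `integral_defect_factor_eq` · `integral_defect_factor_nonneg` · ★ `integral_factor_normTerm_eq_of_le` ·
★★ `integral_ropReal_factor_eq_of_le` · `classSum_ropReal_factor_eq_of_le`; §5 `rterm_eq_factor` · ★ `ropReal_rterm_eq_sum_of_le` ·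
★ `integral_sum_rstepOfSel_eq_of_le`; §6 `normTerm_eq_zero_of_receiver_zero` · `normTerm_ne_old_of_receiver_zero`.
-/

set_option autoImplicit false

noncomputable section

open MeasureTheory Set
open scoped BigOperators ENNReal

namespace Summit.QuantumFields.YangMills.Theorems.N21ThresholdMixtureRStepFactors

open Literature.MathematicalPhysics.QuantumFieldTheory.Balaban1983to89
open Literature.MathematicalPhysics.QuantumFieldTheory.Balaban1983to89.B15.BasicStep (fibreIntegral normTerm RopReal)
open Literature.MathematicalPhysics.QuantumFieldTheory.Balaban1983to89.T4DressedR (FibreIndep fibreIntegral_mul_of_fibreIndep)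
open Literature.MathematicalPhysics.QuantumFieldTheory.Balaban1983to89.T4ObservableTelescope (TermProvisos normTerm_mul_eq_of_fibreIndep
  integrable_of_measurable_abs_le)
open Literature.MathematicalPhysics.QuantumFieldTheory.Balaban1983to89.T4JointDressing (fibreIntegral_nonneg)

variable {P : Params} {j : ℕ} {G : Type*} [GaugeGroup G] [MeasurableSpace G] [HaarData G]
variable [DecidableEq (PBond P j)]

/-! ## §1 One normalised term with fibre-independent sharp factors on both pieces -/

section OneTerm

/-- A nonnegative fibre-independent factor in FRONT pulls out of the real fibre integral: `∫⌈_s(c·f) = c·∫⌈_s f`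
(`T4DressedR.fibreIntegral_mul_of_fibreIndep` in the order used here). [folklore] -/
theorem fibreIntegral_factor_mul (s : Finset (PBond P j)) {c f : Density P j G} (hf : Measurable f) (hc : FibreIndep s c)
    (hc0 : ∀ V, 0 ≤ c V) (V : GaugeField P j G) :
    fibreIntegral s (fun U => c U * f U) V = c V * fibreIntegral s f V := by
  have h : (fun U => c U * f U) = fun U => f U * c U := funext fun U => mul_comm _ _
  rw [h]
  exact fibreIntegral_mul_of_fibreIndep s hf hc hc0 V

/-- ★ **THE NORMALISED TERM WITH SHARP FACTORS**: for fibre-independent nonnegative `c, c″`,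
`normTerm s (c″·f″) (c·f) (V) = 0` if `c″ V = 0`, and `= c V · normTerm s f″ f V` otherwise — the receiving factor CANCELS between the
prefactor and the denominator, the sending factor rides in front, the remainder is the normalised term of the factor-free pieces.
[cite: Balaban1989LargeFieldI, (0.3) p.176] -/
theorem normTerm_factor_mul (s : Finset (PBond P j)) {c c'' f f'' : Density P j G} (hf : Measurable f) (hf'' : Measurable f'')
    (hc : FibreIndep s c) (hc'' : FibreIndep s c'') (hc0 : ∀ V, 0 ≤ c V) (hc''0 : ∀ V, 0 ≤ c'' V) (V : GaugeField P j G) :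
    normTerm s (fun U => c'' U * f'' U) (fun U => c U * f U) V
      = if c'' V = 0 then 0 else c V * normTerm s f'' f V := by
  simp only [normTerm]
  rw [fibreIntegral_factor_mul s hf hc hc0 V, fibreIntegral_factor_mul s hf'' hc'' hc''0 V]
  split_ifs with h
  · rw [h, zero_mul, zero_mul]
  · have h1 : c'' V * (c'' V)⁻¹ = 1 := mul_inv_cancel₀ h
    rw [div_eq_mul_inv, div_eq_mul_inv, mul_inv]
    calc c'' V * f'' V * (c V * fibreIntegral s f V * ((c'' V)⁻¹ * (fibreIntegral s f'' V)⁻¹))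
        = c'' V * (c'' V)⁻¹ * (c V * (f'' V * (fibreIntegral s f V * (fibreIntegral s f'' V)⁻¹))) := by ring
      _ = c V * (f'' V * (fibreIntegral s f V * (fibreIntegral s f'' V)⁻¹)) := by rw [h1, one_mul]

/-- For an IDEMPOTENT receiving factor (`c″·c″ = c″`, e.g. a product of indicators) the case split closes into a product:
`normTerm s (c″·f″) (c·f) (V) = c V · c″ V · normTerm s f″ f V` — a sharp factor over the UNION of the two occurrence sets. [folklore] -/
theorem normTerm_factor_mul_of_idem (s : Finset (PBond P j)) {c c'' f f'' : Density P j G} (hf : Measurable f) (hf'' : Measurable f'')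
    (hc : FibreIndep s c) (hc'' : FibreIndep s c'') (hc0 : ∀ V, 0 ≤ c V) (hc''0 : ∀ V, 0 ≤ c'' V) (V : GaugeField P j G)
    (hidem : c'' V * c'' V = c'' V) :
    normTerm s (fun U => c'' U * f'' U) (fun U => c U * f U) V = c V * c'' V * normTerm s f'' f V := by
  rw [normTerm_factor_mul s hf hf'' hc hc'' hc0 hc''0 V]
  split_ifs with h
  · rw [h, mul_zero, zero_mul]
  · rw [(mul_eq_left₀ h).1 hidem, mul_one]

/-- ★ **SELECTOR-MONOTONE CASE** (`c ≤ c″` pointwise — print: the receiving history coincides with the sending one off the fibre):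
`normTerm s (c″·f″) (c·f) (V) = c V · normTerm s f″ f V` — the sending term's sharp factor survives ℝ VERBATIM. [cite: Balaban1989LargeFieldI, (0.3) p.176] -/
theorem normTerm_factor_mul_of_le (s : Finset (PBond P j)) {c c'' f f'' : Density P j G} (hf : Measurable f) (hf'' : Measurable f'')
    (hc : FibreIndep s c) (hc'' : FibreIndep s c'') (hc0 : ∀ V, 0 ≤ c V) (hc''0 : ∀ V, 0 ≤ c'' V) (V : GaugeField P j G)
    (hle : c V ≤ c'' V) :
    normTerm s (fun U => c'' U * f'' U) (fun U => c U * f U) V = c V * normTerm s f'' f V := by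
  rw [normTerm_factor_mul s hf hf'' hc hc'' hc0 hc''0 V]
  split_ifs with h
  · rw [le_antisymm (h ▸ hle) (hc0 V), zero_mul]
  · rfl

/-- The factor-free remainder is nonnegative for nonnegative pieces. [folklore] -/
theorem normTerm_factor_nonneg (s : Finset (PBond P j)) {f f'' : Density P j G} (hf''0 : ∀ V, 0 ≤ f'' V) (V : GaugeField P j G) :
    0 ≤ normTerm s f'' f V :=
  mul_nonneg (hf''0 V) (div_nonneg (fibreIntegral_nonneg s f V) (fibreIntegral_nonneg s f'' V))

end OneTerm

/-! ## §2 The (0.3) density of factored pieces, indexed by the OLD index -/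

section Rop

variable {R : Type*} [Fintype R]

/-- The typed (0.3) of factored pieces `t_a = c_a·f_a`, summed over the OLD index: each summand is `[c_{sel a} ≠ 0]·c_a` times the
threshold-free normalised term. [cite: Balaban1989LargeFieldI, (0.3) p.176] -/
theorem ropReal_factor_eq_sum (c f : R → Density P j G) (sel : R → R) (fib : R → Finset (PBond P j))
    (hf : ∀ a, Measurable (f a)) (hc : ∀ a, FibreIndep (fib a) (c a)) (hc' : ∀ a, FibreIndep (fib a) (c (sel a)))
    (hc0 : ∀ a V, 0 ≤ c a V) (V : GaugeField P j G) :
    RopReal (fun a U => c a U * f a U) sel fib V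
      = ∑ a, if c (sel a) V = 0 then 0 else c a V * normTerm (fib a) (f (sel a)) (f a) V := by
  simp only [RopReal]
  exact Finset.sum_congr rfl fun a _ => normTerm_factor_mul (fib a) (hf a) (hf (sel a)) (hc a) (hc' a) (hc0 a) (hc0 (sel a)) V

/-- Idempotent factors: the post-ℝ summand of `a` carries the sharp factor `c_a·c_{sel a}` (union of the occurrence sets). [folklore] -/
theorem ropReal_factor_eq_sum_of_idem (c f : R → Density P j G) (sel : R → R) (fib : R → Finset (PBond P j))
    (hf : ∀ a, Measurable (f a)) (hc : ∀ a, FibreIndep (fib a) (c a)) (hc' : ∀ a, FibreIndep (fib a) (c (sel a)))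
    (hc0 : ∀ a V, 0 ≤ c a V) (hidem : ∀ a V, c a V * c a V = c a V) (V : GaugeField P j G) :
    RopReal (fun a U => c a U * f a U) sel fib V = ∑ a, c a V * c (sel a) V * normTerm (fib a) (f (sel a)) (f a) V := by
  simp only [RopReal]
  exact Finset.sum_congr rfl fun a _ =>
    normTerm_factor_mul_of_idem (fib a) (hf a) (hf (sel a)) (hc a) (hc' a) (hc0 a) (hc0 (sel a)) V (hidem (sel a) V)

/-- ★★ **SELECTOR-MONOTONE CASE: ℝ KEEPS THE `hXs` SHAPE EXACTLY** — `ℝρ = Σ_a c_a · normTerm(fib a)(f_{sel a})(f_a)`: the same sharp factor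
as before ℝ in front of a threshold-free nonnegative remainder, for every old index `a`. [cite: Balaban1989LargeFieldI, (0.3) p.176] -/
theorem ropReal_factor_eq_sum_of_le (c f : R → Density P j G) (sel : R → R) (fib : R → Finset (PBond P j))
    (hf : ∀ a, Measurable (f a)) (hc : ∀ a, FibreIndep (fib a) (c a)) (hc' : ∀ a, FibreIndep (fib a) (c (sel a)))
    (hc0 : ∀ a V, 0 ≤ c a V) (hsel : ∀ a V, c a V ≤ c (sel a) V) (V : GaugeField P j G) :
    RopReal (fun a U => c a U * f a U) sel fib V = ∑ a, c a V * normTerm (fib a) (f (sel a)) (f a) V := by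
  simp only [RopReal]
  exact Finset.sum_congr rfl fun a _ =>
    normTerm_factor_mul_of_le (fib a) (hf a) (hf (sel a)) (hc a) (hc' a) (hc0 a) (hc0 (sel a)) V (hsel a V)

end Rop

/-! ## §3 Threshold-parametric families: the multiplier integral of the post-ℝ density -/

section Family

variable {R : Type*} [Fintype R] {Θ : Type*} [MeasurableSpace Θ]

/-- ★ **THE `hXs`∕`hA` PAIR SURVIVES ℝ.**  For a family of sharp factors `c^S_a` indexed by the multiplier space (fibre-independent,
nonnegative, selector-monotone at every `S`, integrable in `S` at the field `V`) and threshold-free `f_a`, the `S`-integral of the post-ℝ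
density against ANY finite measure is `Σ_a (∫ c^S_a(V) dS) · normTerm(fib a)(f_{sel a})(f_a)(V)` — the integrated (profiled) factor in front
of the same threshold-free remainder (13a∕14a's common-box identities supply `∫ c^S_a dS` as the (η)-profiled product). [folklore] -/
theorem integral_ropReal_family_eq_of_le (μ : Measure Θ) (cS : Θ → R → Density P j G) (f : R → Density P j G) (sel : R → R)
    (fib : R → Finset (PBond P j)) (hf : ∀ a, Measurable (f a)) (hc : ∀ S a, FibreIndep (fib a) (cS S a))
    (hc' : ∀ S a, FibreIndep (fib a) (cS S (sel a))) (hc0 : ∀ S a V, 0 ≤ cS S a V)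
    (hsel : ∀ S a V, cS S a V ≤ cS S (sel a) V) (V : GaugeField P j G) (hint : ∀ a, Integrable (fun S => cS S a V) μ) :
    ∫ S, RopReal (fun a U => cS S a U * f a U) sel fib V ∂μ
      = ∑ a, (∫ S, cS S a V ∂μ) * normTerm (fib a) (f (sel a)) (f a) V := by
  have hpt : ∀ S, RopReal (fun a U => cS S a U * f a U) sel fib V = ∑ a, cS S a V * normTerm (fib a) (f (sel a)) (f a) V :=
    fun S => ropReal_factor_eq_sum_of_le (cS S) f sel fib hf (hc S) (hc' S) (hc0 S) (hsel S) V
  simp_rw [hpt]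
  rw [integral_finsetSum _ (fun a _ => (hint a).mul_const _)]
  exact Finset.sum_congr rfl fun a _ => integral_mul_const _ _

end Family

/-! ## §4 (0.4) per summand under SATISFIABLE provisos, the mass defect, and class sums -/

section Mass

omit [GaugeGroup G] [HaarData G] [DecidableEq (PBond P j)] in
/-- The truncated sending factor `[c″ ≠ 0]·c` is measurable. [folklore] -/
theorem measurable_truncSendFactor {c c'' : Density P j G} (hcm : Measurable c) (hc''m : Measurable c'') :
    Measurable (fun V => if c'' V = 0 then 0 else c V) :=
  Measurable.ite (hc''m (measurableSet_singleton 0)) measurable_const hcm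

/-- ★ **(0.4) PER SUMMAND WITH THE RECEIVING CONSTRAINT**: under `TermProvisos s f″ f C` — provisos on the THRESHOLD-FREE parts (measurable,
nonnegative, bounded, `∫⌈_s f″` nowhere zero), hence satisfiable — and bounded measurable fibre-independent factors,
`∫ normTerm s (c″f″) (c f) dV = ∫ f·[c″ ≠ 0]·c dV`. [cite: Balaban1989LargeFieldI, (0.4) p.176] -/
theorem integral_factor_normTerm_eq (s : Finset (PBond P j)) {c c'' f f'' : Density P j G} {C B : ℝ} (hP : TermProvisos s f'' f C)
    (hcm : Measurable c) (hc''m : Measurable c'') (hc : FibreIndep s c) (hc'' : FibreIndep s c'') (hc0 : ∀ V, 0 ≤ c V)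
    (hc''0 : ∀ V, 0 ≤ c'' V) (hcB : ∀ V, c V ≤ B) :
    ∫ V, normTerm s (fun U => c'' U * f'' U) (fun U => c U * f U) V ∂fieldMeasure P j G
      = ∫ V, f V * (if c'' V = 0 then 0 else c V) ∂fieldMeasure P j G := by
  have hw : FibreIndep s (fun V => if c'' V = 0 then 0 else c V) := fun x y => by
    dsimp only
    rw [hc'' x y, hc x y]
  have hw0 : ∀ V, 0 ≤ (if c'' V = 0 then 0 else c V) := fun V => by split_ifs; exacts [le_rfl, hc0 V]
  have hwB : ∀ V, (if c'' V = 0 then 0 else c V) ≤ max B 0 := fun V => by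
    split_ifs; exacts [le_max_right _ _, (hcB V).trans (le_max_left _ _)]
  have hpt : ∀ V, normTerm s (fun U => c'' U * f'' U) (fun U => c U * f U) V
      = normTerm s f'' f V * (if c'' V = 0 then 0 else c V) := fun V => by
    rw [normTerm_factor_mul s hP.old_meas hP.ins_meas hc hc'' hc0 hc''0 V]; split_ifs; exacts [(mul_zero _).symm, mul_comm _ _]
  simp_rw [hpt, normTerm_mul_eq_of_fibreIndep s f'' hP.old_meas hw hw0]
  exact (hP.mul (measurable_truncSendFactor hcm hc''m) hw0 hwB).integral_normTerm

/-- **THE MASS DEFECT OF THE TYPED (0.3) ON INDICATOR-CARRYING PIECES**: `∫ c·f − ∫ normTerm s (c″f″) (c f) = ∫ [c″ = 0]·c·f` — the sending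
mass sitting on the receiver's zero set. [cite: Balaban1989LargeFieldI, (0.4) p.176] -/
theorem integral_defect_factor_eq (s : Finset (PBond P j)) {c c'' f f'' : Density P j G} {C B : ℝ} (hP : TermProvisos s f'' f C)
    (hcm : Measurable c) (hc''m : Measurable c'') (hc : FibreIndep s c) (hc'' : FibreIndep s c'') (hc0 : ∀ V, 0 ≤ c V)
    (hc''0 : ∀ V, 0 ≤ c'' V) (hcB : ∀ V, c V ≤ B) :
    (∫ V, c V * f V ∂fieldMeasure P j G) - ∫ V, normTerm s (fun U => c'' U * f'' U) (fun U => c U * f U) V ∂fieldMeasure P j G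
      = ∫ V, (if c'' V = 0 then c V * f V else 0) ∂fieldMeasure P j G := by
  rw [integral_factor_normTerm_eq s hP hcm hc''m hc hc'' hc0 hc''0 hcB]
  have hcB' : ∀ V, |c V| ≤ max B 0 := fun V => by rw [abs_of_nonneg (hc0 V)]; exact (hcB V).trans (le_max_left _ _)
  have h1 : Integrable (fun V => f V * c V) (fieldMeasure P j G) :=
    T4ObservableTelescope.integrable_mul_bdd hP.integrable_old hcm hcB'
  have hwB : ∀ V, |(if c'' V = 0 then 0 else c V)| ≤ max B 0 := fun V => by
    split_ifs; exacts [abs_zero.le.trans (le_max_right _ _), hcB' V]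
  have h2 : Integrable (fun V => f V * (if c'' V = 0 then 0 else c V)) (fieldMeasure P j G) :=
    T4ObservableTelescope.integrable_mul_bdd hP.integrable_old (measurable_truncSendFactor hcm hc''m) hwB
  have hcf : (fun V => c V * f V) = fun V => f V * c V := funext fun V => mul_comm _ _
  rw [hcf, ← integral_sub h1 h2]
  refine integral_congr_ae (Filter.Eventually.of_forall fun V => ?_)
  show f V * c V - f V * (if c'' V = 0 then 0 else c V) = if c'' V = 0 then c V * f V else 0
  split_ifs
  · rw [mul_zero, sub_zero, mul_comm]
  · rw [sub_self]

/-- The mass defect is nonnegative (the typed (0.3) never GAINS mass on nonnegative factored pieces). [folklore] -/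
theorem integral_defect_factor_nonneg (s : Finset (PBond P j)) {c c'' f f'' : Density P j G} {C B : ℝ} (hP : TermProvisos s f'' f C)
    (hcm : Measurable c) (hc''m : Measurable c'') (hc : FibreIndep s c) (hc'' : FibreIndep s c'') (hc0 : ∀ V, 0 ≤ c V)
    (hc''0 : ∀ V, 0 ≤ c'' V) (hcB : ∀ V, c V ≤ B) :
    ∫ V, normTerm s (fun U => c'' U * f'' U) (fun U => c U * f U) V ∂fieldMeasure P j G ≤ ∫ V, c V * f V ∂fieldMeasure P j G := by
  rw [← sub_nonneg, integral_defect_factor_eq s hP hcm hc''m hc hc'' hc0 hc''0 hcB]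
  exact integral_nonneg fun V => by
    dsimp only
    split_ifs
    · exact mul_nonneg (hc0 V) (hP.old_nonneg V)
    · exact le_rfl

/-- ★ **(0.4) PER SUMMAND, EXACT, in the selector-monotone case**: `c ≤ c″` ⇒ `∫ normTerm s (c″f″) (c f) = ∫ c·f`.
[cite: Balaban1989LargeFieldI, (0.4) p.176] -/
theorem integral_factor_normTerm_eq_of_le (s : Finset (PBond P j)) {c c'' f f'' : Density P j G} {C B : ℝ} (hP : TermProvisos s f'' f C)
    (hcm : Measurable c) (hc''m : Measurable c'') (hc : FibreIndep s c) (hc'' : FibreIndep s c'') (hc0 : ∀ V, 0 ≤ c V)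
    (hc''0 : ∀ V, 0 ≤ c'' V) (hcB : ∀ V, c V ≤ B) (hle : ∀ V, c V ≤ c'' V) :
    ∫ V, normTerm s (fun U => c'' U * f'' U) (fun U => c U * f U) V ∂fieldMeasure P j G = ∫ V, c V * f V ∂fieldMeasure P j G := by
  rw [integral_factor_normTerm_eq s hP hcm hc''m hc hc'' hc0 hc''0 hcB]
  refine integral_congr_ae (Filter.Eventually.of_forall fun V => ?_)
  show f V * (if c'' V = 0 then 0 else c V) = c V * f V
  split_ifs with h
  · rw [le_antisymm (h ▸ hle V) (hc0 V), mul_zero, zero_mul]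
  · rw [mul_comm]

variable {R : Type*} [Fintype R]

/-- ★★ **(0.4) FOR THE TYPED (0.3) UNDER SATISFIABLE PROVISOS**: factored pieces `t_a = c_a·f_a` with fibre-independent bounded sharp factors,
selector-monotone `c_a ≤ c_{sel a}`, and `TermProvisos (fib a) f_{sel a} f_a C` on the threshold-free parts ⇒ `∫ ℝρ = Σ_a ∫ t_a` — b01's
`integral_ropReal_eq` with its unsatisfiable `hden` on indicator-carrying receivers replaced. [cite: Balaban1989LargeFieldI, (0.4) p.176] -/
theorem integral_ropReal_factor_eq_of_le (c f : R → Density P j G) (sel : R → R) (fib : R → Finset (PBond P j)) {C B : ℝ}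
    (hP : ∀ a, TermProvisos (fib a) (f (sel a)) (f a) C) (hcm : ∀ a, Measurable (c a)) (hc : ∀ a, FibreIndep (fib a) (c a))
    (hc' : ∀ a, FibreIndep (fib a) (c (sel a))) (hc0 : ∀ a V, 0 ≤ c a V) (hcB : ∀ a V, c a V ≤ B)
    (hsel : ∀ a V, c a V ≤ c (sel a) V) :
    ∫ V, RopReal (fun a U => c a U * f a U) sel fib V ∂fieldMeasure P j G = ∑ a, ∫ V, c a V * f a V ∂fieldMeasure P j G := by
  have hcB' : ∀ a V, |c a V| ≤ max B 0 := fun a V => by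
    rw [abs_of_nonneg (hc0 a V)]; exact (hcB a V).trans (le_max_left _ _)
  have hsum : ∀ a, Integrable (fun V => c a V * normTerm (fib a) (f (sel a)) (f a) V) (fieldMeasure P j G) := fun a =>
    (T4ObservableTelescope.integrable_mul_bdd (hP a).integrable_normTerm (hcm a) (hcB' a)).congr
      (Filter.Eventually.of_forall fun V => mul_comm _ _)
  simp_rw [ropReal_factor_eq_sum_of_le c f sel fib (fun a => (hP a).old_meas) hc hc' hc0 hsel]
  rw [integral_finsetSum _ (fun a _ => hsum a)]
  refine Finset.sum_congr rfl fun a _ => ?_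
  rw [← integral_factor_normTerm_eq_of_le (fib a) (hP a) (hcm a) (hcm (sel a)) (hc a) (hc' a) (hc0 a) (hc0 (sel a)) (hcB a)
    (hsel a)]
  exact integral_congr_ae (Filter.Eventually.of_forall fun V =>
    (normTerm_factor_mul_of_le (fib a) (hP a).old_meas (hP a).ins_meas (hc a) (hc' a) (hc0 a) (hc0 (sel a)) V (hsel a V)).symm)

omit [Fintype R] in
/-- **OLD-CLASS WEIGHTS ARE PRESERVED**: for every class `Cl` of old indices the post-ℝ summands of `Cl` have the total mass of the pre-ℝ
pieces of `Cl` — so a decomposition of unity (E1∕E2 face) and every class-relative LINEAR bound (N20 face) at a threshold vector pass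
through ℝ unchanged. [cite: Balaban1989LargeFieldI, (0.4) p.176] -/
theorem classSum_ropReal_factor_eq_of_le (c f : R → Density P j G) (sel : R → R) (fib : R → Finset (PBond P j)) {C B : ℝ}
    (hP : ∀ a, TermProvisos (fib a) (f (sel a)) (f a) C) (hcm : ∀ a, Measurable (c a)) (hc : ∀ a, FibreIndep (fib a) (c a))
    (hc' : ∀ a, FibreIndep (fib a) (c (sel a))) (hc0 : ∀ a V, 0 ≤ c a V) (hcB : ∀ a V, c a V ≤ B)
    (hsel : ∀ a V, c a V ≤ c (sel a) V) (Cl : Finset R) :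
    ∑ a ∈ Cl, ∫ V, normTerm (fib a) (fun U => c (sel a) U * f (sel a) U) (fun U => c a U * f a U) V ∂fieldMeasure P j G
      = ∑ a ∈ Cl, ∫ V, c a V * f a V ∂fieldMeasure P j G :=
  Finset.sum_congr rfl fun a _ =>
    integral_factor_normTerm_eq_of_le (fib a) (hP a) (hcm a) (hcm (sel a)) (hc a) (hc' a) (hc0 a) (hc0 (sel a)) (hcB a) (hsel a)

end Mass

/-! ## §5 At FILE 7's letters: the R-stepped (2.18) representation with the pinned factor split off-fibre × on-fibre -/

section AtRepr

open Literature.MathematicalPhysics.QuantumFieldTheory.Balaban1983to89.Node00 (rterm rstepOfSel sum_rstepOfSel_eq)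

variable (r : Step.Repr218 P G j) (sel : r.Adm → r.Adm) (fib : r.Adm → Finset (PBond P j))

omit [MeasurableSpace G] [HaarData G] [DecidableEq (PBond P j)] in
/-- With the pinned factor split `r.χ a = cOut a · cFib a`, FILE 7's term is `cOut a · g a`, `g a := cFib a · r.TexpA a`.
[cite: Balaban1988Convergent, (2.18) p.257 (bookkeeping)] -/
theorem rterm_eq_factor (cOut cFib : r.Adm → Density P j G) (hχ : ∀ a V, r.χ a V = cOut a V * cFib a V) :
    rterm r = fun a U => cOut a U * (cFib a U * r.TexpA a U) := by
  funext a U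
  show r.χ a U * r.TexpA a U = cOut a U * (cFib a U * r.TexpA a U)
  rw [hχ a U, mul_assoc]

/-- ★ **THE R-STEPPED (2.18) DENSITY, OLD-INDEXED**: with `cOut` fibre-independent, nonnegative and selector-monotone,
`Σ_{a′} χ(a′)(𝐓e^A)′(a′) = RopReal (rterm r) sel fib = Σ_a cOut a · normTerm(fib a)(g (sel a))(g a)` — the off-fibre pinned factor of the
SENDING sequence in front of a normalised slot whose definition reads NO off-fibre threshold. [cite: Balaban1989LargeFieldI, (0.3) p.176] -/
theorem ropReal_rterm_eq_sum_of_le (cOut cFib : r.Adm → Density P j G) (hχ : ∀ a V, r.χ a V = cOut a V * cFib a V)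
    (hg : ∀ a, Measurable (fun U => cFib a U * r.TexpA a U)) (hc : ∀ a, FibreIndep (fib a) (cOut a))
    (hc' : ∀ a, FibreIndep (fib a) (cOut (sel a))) (hc0 : ∀ a V, 0 ≤ cOut a V) (hsel : ∀ a V, cOut a V ≤ cOut (sel a) V)
    (V : GaugeField P j G) :
    ∑ a, (rstepOfSel r sel fib).χ a V * (rstepOfSel r sel fib).TexpA a V
      = ∑ a, cOut a V * normTerm (fib a) (fun U => cFib (sel a) U * r.TexpA (sel a) U) (fun U => cFib a U * r.TexpA a U) V := by
  rw [sum_rstepOfSel_eq, rterm_eq_factor r cOut cFib hχ]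
  exact ropReal_factor_eq_sum_of_le cOut (fun a U => cFib a U * r.TexpA a U) sel fib hg hc hc' hc0 hsel V

/-- ★ **FILE 7's (0.4) with `hprov` REPLACED**: under provisos on the on-fibre slots `g a = cFib a · r.TexpA a` (satisfiable: no off-fibre
indicator in the denominators) and off-fibre selector-monotonicity, `∫ Σ_{a′} χ(a′)(𝐓e^A)′(a′) dV = ∫ Σ_a χ(a)(𝐓e^A)(a) dV`.  FILE 8's
`rstepSlotOfRecord` is the instance `rstepOfSel_sliceOfRecord` (`rfl`). [cite: Balaban1989LargeFieldI, (0.4) p.176] -/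
theorem integral_sum_rstepOfSel_eq_of_le (cOut cFib : r.Adm → Density P j G) (hχ : ∀ a V, r.χ a V = cOut a V * cFib a V)
    {C B : ℝ} (hP : ∀ a, TermProvisos (fib a) (fun U => cFib (sel a) U * r.TexpA (sel a) U) (fun U => cFib a U * r.TexpA a U) C)
    (hcm : ∀ a, Measurable (cOut a)) (hc : ∀ a, FibreIndep (fib a) (cOut a)) (hc' : ∀ a, FibreIndep (fib a) (cOut (sel a)))
    (hc0 : ∀ a V, 0 ≤ cOut a V) (hcB : ∀ a V, cOut a V ≤ B) (hsel : ∀ a V, cOut a V ≤ cOut (sel a) V) :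
    ∫ V, ∑ a, (rstepOfSel r sel fib).χ a V * (rstepOfSel r sel fib).TexpA a V ∂fieldMeasure P j G
      = ∫ V, ∑ a, r.χ a V * r.TexpA a V ∂fieldMeasure P j G := by
  have hcB' : ∀ a V, |cOut a V| ≤ max B 0 := fun a V => by
    rw [abs_of_nonneg (hc0 a V)]; exact (hcB a V).trans (le_max_left _ _)
  have hint : ∀ a, Integrable (fun V => cOut a V * (cFib a V * r.TexpA a V)) (fieldMeasure P j G) := fun a =>
    (T4ObservableTelescope.integrable_mul_bdd (hP a).integrable_old (hcm a) (hcB' a)).congr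
      (Filter.Eventually.of_forall fun V => mul_comm _ _)
  simp_rw [sum_rstepOfSel_eq]
  rw [rterm_eq_factor r cOut cFib hχ,
    integral_ropReal_factor_eq_of_le cOut (fun a U => cFib a U * r.TexpA a U) sel fib hP hcm hc hc' hc0 hcB hsel,
    ← integral_finsetSum _ (fun a _ => hint a)]
  refine integral_congr_ae (Filter.Eventually.of_forall fun V => Finset.sum_congr rfl fun a _ => ?_)
  show cOut a V * (cFib a V * r.TexpA a V) = r.χ a V * r.TexpA a V
  rw [hχ a V, mul_assoc]

end AtRepr

/-! ## §6 Guard: the typed (0.3) kills the sending term wherever the receiving term vanishes -/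

section Guard

/-- Wherever the receiving term vanishes, the sending term contributes NOTHING to the typed (0.3), whatever its own value there.
[cite: Balaban1989LargeFieldI, (0.3) p.176] -/
theorem normTerm_eq_zero_of_receiver_zero (s : Finset (PBond P j)) (new old : Density P j G) (V : GaugeField P j G)
    (h : new V = 0) : normTerm s new old V = 0 := by
  simp only [normTerm, h, zero_mul]

/-- Hence (0.3) is NOT term-wise mass-preserving without the selector-monotonicity of §4: at a field where the receiver vanishes and the
sender does not, the normalised term differs from the sending term. [folklore] -/
theorem normTerm_ne_old_of_receiver_zero (s : Finset (PBond P j)) (new old : Density P j G) (V : GaugeField P j G)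
    (h : new V = 0) (hold : old V ≠ 0) : normTerm s new old V ≠ old V := by
  rw [normTerm_eq_zero_of_receiver_zero s new old V h]
  exact hold.symm

end Guard

end Summit.QuantumFields.YangMills.Theorems.N21ThresholdMixtureRStepFactors

end
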